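import Summits.QuantumFields.YangMills.Theorems.VirialFluxGapRadialProfile
import Summits.QuantumFields.YangMills.Theorems.VirialFluxGapRingDeficitFrameDerivative
import HarnessLib

/-!
# Route `VirialFluxGap` (YangMills): the ZERO-MODE BLOCK FIELD of the central charts — coefficients, own-curve derivatives and the EXACT
# divergence `(3/2)·Σ_blocks σ_B·⟨Re q⟩_B ≤ 6`

First brick of the CENTRAL CHARTS (C1) of the Euler field for ⟨stmt-QuantumFields-24141⟩ (assignment LEAD ym-line-sfw-p2 g92, 2026-08-30
22:49Z; recipe: `X_c = ½·P_z(signed Im-coordinates) + (resolvent part on P_z^⊥)` in the normalisation `X·F₀ ≈ 2F₀` of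
✓`EulerFieldReduction.periodicSoftness_of_eulerField`).  `P_z` is the orthogonal projector onto the `12` CONSTANT MODES: the average over the
block `B_k` of all slice links of spatial direction `k` (`k = 1,2,3`; `|B_k| = 2L·L³`) and over the seam block (`|B| = L³`), componentwise in
the three frame directions `u_a = i, j, k`.  In the frame language of the `DF` package:

* §1 the unit directions `zUnit a` (`a : Fin 3`) and their matrices `quatMatrix (zUnit a) ∈ 𝔰𝔲(2)`;
* §2 the coefficients `zsliceCoeff σ k a P = ½·σ·⟨Im_a q⟩_{B_k}` and `zseamCoeff σ a P = ½·σ·⟨Im_a q⟩_{seam}` (`σ ∈ [−1,1]` the sign of the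
  chart's central toron on the block), continuous-linear in the coordinates (`regular`: continuous, bounded, strongly measurable);
* §3 ★★ own-curve derivatives: along `sliceCurve i (x,k) (quatMatrix (zUnit a))` the coefficient `zsliceCoeff σ k a` has derivative
  `½·σ·Im_a(q(P_{i,(x,k)})·u_a)/|B_k|` at the moving point (only the moving variable of the block contributes); seam alike;
* §4 ★★★ `zeroModeField_div_eq` ∕ `zeroModeField_div_le` — summing over ALL directions `((i,(x,k)),a)` and `(x,a)`:
  `div X_z = (3/2)·(Σ_k σ_k·⟨Re q⟩_{B_k} + σ₄·⟨Re q⟩_{seam}) ≤ 6` EVERYWHERE on `Ω_L` — the `12 × ½` of the weight count, exact and β-free.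

HONEST FRAMING: the zero-mode HALF of the central-chart field only — its action on `F₀` ((E1) on the quartic cone, ✓`ConstantHistoryDeficit`)
and the transverse resolvent half are NOT here; ⟨24141⟩ stays OPEN; the Yang–Mills mass gap is NOT proved; no summit is proved by a line.
Three plumbing `def`s (`zUnit`, `zsliceCoeff`, `zseamCoeff`), theorems otherwise; 0 `sorry`, standard axioms.  Width seat `ym-line-sfw-p2-w3`
g58 (cell ym-idea-1, free hands), `--supports stmt-QuantumFields-24141`.
References: [cite: arXiv220412737, §2 (2.4) (p. 10)]; [cite: CosteEtAl1985]; [cite: Luscher1983, §2].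
-/

set_option autoImplicit false

noncomputable section

open scoped Matrix BigOperators ContDiff Topology Quaternion
open MeasureTheory
open Literature.MathematicalPhysics.QuantumFieldTheory hiding SU2
open Literature.MathematicalPhysics.QuantumLattice
open Literature.MathematicalPhysics.QuantumFieldTheory.SUNBakryEmery (expSU matTop)

namespace Summit.QuantumFields.YangMills.Theorems.VirialFluxGap.FrameDerivative

open Summit.QuantumFields.YangMills.Theorems.FemtoTransferGap

variable {L : ℕ} [NeZero L]

open scoped Matrix.Norms.Frobenius

attribute [local instance 2000] Literature.MathematicalPhysics.QuantumFieldTheory.SUNBakryEmery.matTop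

/-! ## §1 The three unit directions -/

/-- The unit imaginary quaternions `i, j, k`, indexed by `Fin 3`. [folklore] -/
def zUnit (a : Fin 3) : ℍ := ![⟨0, 1, 0, 0⟩, ⟨0, 0, 1, 0⟩, ⟨0, 0, 0, 1⟩] a

section Units

omit [NeZero L]

/-- `quatMatrix (zUnit a)` is skew-Hermitian. [folklore] -/
theorem quatMatrix_zUnit_conjTranspose (a : Fin 3) : (quatMatrix (zUnit a))ᴴ = -quatMatrix (zUnit a) := by
  fin_cases a
  · exact quatMatrix_im_conjTranspose 1 0 0
  · exact quatMatrix_im_conjTranspose 0 1 0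
  · exact quatMatrix_im_conjTranspose 0 0 1

/-- `quatMatrix (zUnit a)` is traceless. [folklore] -/
theorem quatMatrix_zUnit_trace (a : Fin 3) : (quatMatrix (zUnit a)).trace = 0 := by
  fin_cases a
  · exact quatMatrix_im_trace 1 0 0
  · exact quatMatrix_im_trace 0 1 0
  · exact quatMatrix_im_trace 0 0 1

/-- The `a`-th imaginary part read through the first row: `Im₁ = Im M₀₀`, `Im₂ = Re M₀₁`, `Im₃ = Im M₀₁`. [folklore] -/
theorem imEntry_quatMatrix (a : Fin 3) (p : ℍ) :
    (![((quatMatrix p) 0 0).im, ((quatMatrix p) 0 1).re, ((quatMatrix p) 0 1).im] : Fin 3 → ℝ) a = ![p.imI, p.imJ, p.imK] a := by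
  fin_cases a <;> simp

/-- ★ **Quaternion trace identity**: `Σ_a Im_a(q·u_a) = 3·Re q`. [folklore] -/
theorem sum_im_mul_zUnit (q : ℍ) : ∑ a : Fin 3, (![(q * zUnit a).imI, (q * zUnit a).imJ, (q * zUnit a).imK] : Fin 3 → ℝ) a = 3 * q.re := by
  rw [Fin.sum_univ_three]
  simp only [zUnit, Matrix.cons_val_zero, Matrix.cons_val_one, Matrix.cons_val]
  simp only [Quaternion.imI_mul, Quaternion.imJ_mul, Quaternion.imK_mul]
  ring

end Units

/-! ## §2 The block-averaged signed coefficients -/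

/-- The zero-mode coefficient of the slice block `k` in the frame direction `a`, with sign `σ`: `½·σ·⟨Im_a q⟩_{B_k}`. [cite: CosteEtAl1985] -/
def zsliceCoeff (L : ℕ) [NeZero L] (σ : ℝ) (k a : Fin 3) (P : (Fin (2 * L - 1 + 1) → GaugeConfig 3 L SU2) × (Site 3 L → SU2)) : ℝ :=
  (1 / 2 : ℝ) * σ * ((∑ i : Fin (2 * L - 1 + 1), ∑ x : Site 3 L,
    (![(su2Quat (P.1 i (x, k))).imI, (su2Quat (P.1 i (x, k))).imJ, (su2Quat (P.1 i (x, k))).imK] : Fin 3 → ℝ) a) /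
      (((2 * L - 1 + 1 : ℕ) : ℝ) * (L : ℝ) ^ 3))

/-- The zero-mode coefficient of the seam block in the frame direction `a`, with sign `σ`: `½·σ·⟨Im_a q⟩_{seam}`. [cite: CosteEtAl1985] -/
def zseamCoeff (L : ℕ) [NeZero L] (σ : ℝ) (a : Fin 3) (P : (Fin (2 * L - 1 + 1) → GaugeConfig 3 L SU2) × (Site 3 L → SU2)) : ℝ :=
  (1 / 2 : ℝ) * σ * ((∑ x : Site 3 L, (![(su2Quat (P.2 x)).imI, (su2Quat (P.2 x)).imJ, (su2Quat (P.2 x)).imK] : Fin 3 → ℝ) a) / ((L : ℝ) ^ 3))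

/-- The slice-block coefficient factors through the coordinates as a continuous linear functional. [folklore] -/
theorem exists_zsliceCoeff_clm (σ : ℝ) (k a : Fin 3) :
    ∃ ℓ : ((Fin (2 * L - 1 + 1) → Edge 3 L → Matrix (Fin 2) (Fin 2) ℂ) × (Site 3 L → Matrix (Fin 2) (Fin 2) ℂ)) →L[ℝ] ℝ,
      (∀ M, ℓ M = (1 / 2 : ℝ) * σ * ((∑ i : Fin (2 * L - 1 + 1), ∑ x : Site 3 L,
        (![((M.1 i (x, k)) 0 0).im, ((M.1 i (x, k)) 0 1).re, ((M.1 i (x, k)) 0 1).im] : Fin 3 → ℝ) a) /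
          (((2 * L - 1 + 1 : ℕ) : ℝ) * (L : ℝ) ^ 3))) ∧
      ∀ P, zsliceCoeff L σ k a P = ℓ (ringCoord L P) := by
  refine ⟨LinearMap.toContinuousLinearMap
      { toFun := fun M => (1 / 2 : ℝ) * σ * ((∑ i : Fin (2 * L - 1 + 1), ∑ x : Site 3 L,
          (![((M.1 i (x, k)) 0 0).im, ((M.1 i (x, k)) 0 1).re, ((M.1 i (x, k)) 0 1).im] : Fin 3 → ℝ) a) /
            (((2 * L - 1 + 1 : ℕ) : ℝ) * (L : ℝ) ^ 3)),
        map_add' := fun M N => by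
          fin_cases a <;> simp [Finset.sum_add_distrib] <;> ring,
        map_smul' := fun c M => by
          fin_cases a <;> simp <;> simp only [← Finset.mul_sum] <;> ring },
    fun M => rfl, fun P => ?_⟩
  fin_cases a <;> rfl

/-- The seam-block coefficient factors through the coordinates as a continuous linear functional. [folklore] -/
theorem exists_zseamCoeff_clm (σ : ℝ) (a : Fin 3) :
    ∃ ℓ : ((Fin (2 * L - 1 + 1) → Edge 3 L → Matrix (Fin 2) (Fin 2) ℂ) × (Site 3 L → Matrix (Fin 2) (Fin 2) ℂ)) →L[ℝ] ℝ,
      (∀ M, ℓ M = (1 / 2 : ℝ) * σ * ((∑ x : Site 3 L,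
        (![((M.2 x) 0 0).im, ((M.2 x) 0 1).re, ((M.2 x) 0 1).im] : Fin 3 → ℝ) a) / ((L : ℝ) ^ 3))) ∧
      ∀ P, zseamCoeff L σ a P = ℓ (ringCoord L P) := by
  refine ⟨LinearMap.toContinuousLinearMap
      { toFun := fun M => (1 / 2 : ℝ) * σ * ((∑ x : Site 3 L,
          (![((M.2 x) 0 0).im, ((M.2 x) 0 1).re, ((M.2 x) 0 1).im] : Fin 3 → ℝ) a) / ((L : ℝ) ^ 3)),
        map_add' := fun M N => by
          fin_cases a <;> simp [Finset.sum_add_distrib] <;> ring,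
        map_smul' := fun c M => by
          fin_cases a <;> simp <;> simp only [← Finset.mul_sum] <;> ring },
    fun M => rfl, fun P => ?_⟩
  fin_cases a <;> rfl

/-! ## §3 Own-curve derivatives of the block coefficients -/

/-- The derivative of the slice-block coefficient along the frame curve of its own block's variable `(i,(x,k))` in the direction `u_a`, as a
function of the (moving) ring history: `½·σ·Im_a(q(P_{i,(x,k)})·u_a)/|B_k|`. [folklore] -/
def zsliceDeriv (L : ℕ) [NeZero L] (σ : ℝ) (k a : Fin 3) (i : Fin (2 * L - 1 + 1)) (x : Site 3 L)
    (P : (Fin (2 * L - 1 + 1) → GaugeConfig 3 L SU2) × (Site 3 L → SU2)) : ℝ :=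
  (1 / 2 : ℝ) * σ * ((![(su2Quat (P.1 i (x, k)) * zUnit a).imI, (su2Quat (P.1 i (x, k)) * zUnit a).imJ,
    (su2Quat (P.1 i (x, k)) * zUnit a).imK] : Fin 3 → ℝ) a / (((2 * L - 1 + 1 : ℕ) : ℝ) * (L : ℝ) ^ 3))

/-- The derivative of the seam-block coefficient along the frame curve of the seam variable `x` in the direction `u_a`. [folklore] -/
def zseamDeriv (L : ℕ) [NeZero L] (σ : ℝ) (a : Fin 3) (x : Site 3 L)
    (P : (Fin (2 * L - 1 + 1) → GaugeConfig 3 L SU2) × (Site 3 L → SU2)) : ℝ :=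
  (1 / 2 : ℝ) * σ * ((![(su2Quat (P.2 x) * zUnit a).imI, (su2Quat (P.2 x) * zUnit a).imJ, (su2Quat (P.2 x) * zUnit a).imK] : Fin 3 → ℝ) a /
    ((L : ℝ) ^ 3))

/-- The block sum of first-row entries of a slice tangent family collapses to the moving variable. [folklore] -/
theorem sum_imEntry_sliceTangent (i : Fin (2 * L - 1 + 1)) (x : Site 3 L) (k a : Fin 3) (Y : Matrix (Fin 2) (Fin 2) ℂ)
    (P : (Fin (2 * L - 1 + 1) → GaugeConfig 3 L SU2) × (Site 3 L → SU2)) :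
    (∑ i' : Fin (2 * L - 1 + 1), ∑ x' : Site 3 L,
      (![(((sliceTangent i (x, k) Y P).1 i' (x', k)) 0 0).im, (((sliceTangent i (x, k) Y P).1 i' (x', k)) 0 1).re,
        (((sliceTangent i (x, k) Y P).1 i' (x', k)) 0 1).im] : Fin 3 → ℝ) a) =
      (![(((P.1 i (x, k) : Matrix (Fin 2) (Fin 2) ℂ) * Y) 0 0).im, (((P.1 i (x, k) : Matrix (Fin 2) (Fin 2) ℂ) * Y) 0 1).re,
        (((P.1 i (x, k) : Matrix (Fin 2) (Fin 2) ℂ) * Y) 0 1).im] : Fin 3 → ℝ) a := by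
  have hzero : ∀ (i' : Fin (2 * L - 1 + 1)) (x' : Site 3 L), ¬(i' = i ∧ x' = x) →
      (![(((sliceTangent i (x, k) Y P).1 i' (x', k)) 0 0).im, (((sliceTangent i (x, k) Y P).1 i' (x', k)) 0 1).re,
        (((sliceTangent i (x, k) Y P).1 i' (x', k)) 0 1).im] : Fin 3 → ℝ) a = 0 := by
    intro i' x' h
    have hne : ¬(i' = i ∧ ((x', k) : Edge 3 L) = (x, k)) := fun h' => h ⟨h'.1, (Prod.mk.inj h'.2).1⟩
    have ht : (sliceTangent i (x, k) Y P).1 i' (x', k) = 0 := by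
      simp only [sliceTangent, sliceDir_of_ne Y hne, Matrix.mul_zero]
    rw [ht]
    fin_cases a <;> simp
  have hself : (sliceTangent i (x, k) Y P).1 i (x, k) = (P.1 i (x, k) : Matrix (Fin 2) (Fin 2) ℂ) * Y := by
    simp only [sliceTangent, sliceDir_self]
  rw [Finset.sum_eq_single i, Finset.sum_eq_single x, hself]
  · intro x' _ hx'
    exact hzero i x' (fun h => hx' h.2)
  · intro h; exact absurd (Finset.mem_univ x) h
  · intro i' _ hi'
    exact Finset.sum_eq_zero fun x' _ => hzero i' x' (fun h => hi' h.1)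
  · intro h; exact absurd (Finset.mem_univ i) h

/-- The seam sum of first-row entries of a seam tangent family collapses to the moving variable. [folklore] -/
theorem sum_imEntry_seamTangent (x : Site 3 L) (a : Fin 3) (Y : Matrix (Fin 2) (Fin 2) ℂ)
    (P : (Fin (2 * L - 1 + 1) → GaugeConfig 3 L SU2) × (Site 3 L → SU2)) :
    (∑ x' : Site 3 L, (![(((seamTangent x Y P).2 x') 0 0).im, (((seamTangent x Y P).2 x') 0 1).re,
        (((seamTangent x Y P).2 x') 0 1).im] : Fin 3 → ℝ) a) =
      (![(((P.2 x : Matrix (Fin 2) (Fin 2) ℂ) * Y) 0 0).im, (((P.2 x : Matrix (Fin 2) (Fin 2) ℂ) * Y) 0 1).re,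
        (((P.2 x : Matrix (Fin 2) (Fin 2) ℂ) * Y) 0 1).im] : Fin 3 → ℝ) a := by
  have hself : (seamTangent x Y P).2 x = (P.2 x : Matrix (Fin 2) (Fin 2) ℂ) * Y := by
    simp only [seamTangent, seamDir_self]
  rw [Finset.sum_eq_single x, hself]
  · intro x' _ hx'
    have ht : (seamTangent x Y P).2 x' = 0 := by
      simp only [seamTangent, seamDir_of_ne Y hx', Matrix.mul_zero]
    rw [ht]
    fin_cases a <;> simp
  · intro h; exact absurd (Finset.mem_univ x) h

/-- First-row entries of `U·quatMatrix p` are the imaginary parts of `su2Quat U · p`. [folklore] -/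
theorem imEntry_coe_mul_quatMatrix (a : Fin 3) (U : SU2) (p : ℍ) :
    (![(((U : Matrix (Fin 2) (Fin 2) ℂ) * quatMatrix p) 0 0).im, (((U : Matrix (Fin 2) (Fin 2) ℂ) * quatMatrix p) 0 1).re,
        (((U : Matrix (Fin 2) (Fin 2) ℂ) * quatMatrix p) 0 1).im] : Fin 3 → ℝ) a =
      ![(su2Quat U * p).imI, (su2Quat U * p).imJ, (su2Quat U * p).imK] a := by
  rw [coe_mul_quatMatrix]
  exact imEntry_quatMatrix a _

/-- ★★ **Own-curve derivative of the slice-block coefficient**: along `sliceCurve i (x,k) (quatMatrix (zUnit a))` the coefficient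
`zsliceCoeff σ k a` has derivative `zsliceDeriv σ k a i x` at the moving point, at EVERY parameter. [cite: arXiv220412737, §2 (2.4) (p. 10)] -/
theorem hasDerivAt_zsliceCoeff (σ : ℝ) (k a : Fin 3) (i : Fin (2 * L - 1 + 1)) (x : Site 3 L)
    (P : (Fin (2 * L - 1 + 1) → GaugeConfig 3 L SU2) × (Site 3 L → SU2)) (t : ℝ) :
    HasDerivAt (fun s => zsliceCoeff L σ k a (P * sliceCurve i (x, k) (quatMatrix_zUnit_conjTranspose a) (quatMatrix_zUnit_trace a) s))
      (zsliceDeriv L σ k a i x (P * sliceCurve i (x, k) (quatMatrix_zUnit_conjTranspose a) (quatMatrix_zUnit_trace a) t)) t := by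
  obtain ⟨ℓ, hℓ, hφ⟩ := exists_zsliceCoeff_clm (L := L) σ k a
  have heq : (fun s => zsliceCoeff L σ k a (P * sliceCurve i (x, k) (quatMatrix_zUnit_conjTranspose a) (quatMatrix_zUnit_trace a) s)) =
      fun s => ℓ (ringCoord L (P * sliceCurve i (x, k) (quatMatrix_zUnit_conjTranspose a) (quatMatrix_zUnit_trace a) s)) :=
    funext fun s => hφ _
  rw [heq]
  have h := hasDerivAt_comp_ringCoord_sliceCurve (L := L) ℓ.contDiff i (x, k) (quatMatrix_zUnit_conjTranspose a) (quatMatrix_zUnit_trace a) P t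
  refine h.congr_deriv ?_
  rw [ℓ.fderiv, hℓ, sum_imEntry_sliceTangent, imEntry_coe_mul_quatMatrix, zsliceDeriv]

/-- ★★ **Own-curve derivative of the seam-block coefficient.** [cite: arXiv220412737, §2 (2.4) (p. 10)] -/
theorem hasDerivAt_zseamCoeff (σ : ℝ) (a : Fin 3) (x : Site 3 L)
    (P : (Fin (2 * L - 1 + 1) → GaugeConfig 3 L SU2) × (Site 3 L → SU2)) (t : ℝ) :
    HasDerivAt (fun s => zseamCoeff L σ a (P * seamCurve x (quatMatrix_zUnit_conjTranspose a) (quatMatrix_zUnit_trace a) s))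
      (zseamDeriv L σ a x (P * seamCurve x (quatMatrix_zUnit_conjTranspose a) (quatMatrix_zUnit_trace a) t)) t := by
  obtain ⟨ℓ, hℓ, hφ⟩ := exists_zseamCoeff_clm (L := L) σ a
  have heq : (fun s => zseamCoeff L σ a (P * seamCurve x (quatMatrix_zUnit_conjTranspose a) (quatMatrix_zUnit_trace a) s)) =
      fun s => ℓ (ringCoord L (P * seamCurve x (quatMatrix_zUnit_conjTranspose a) (quatMatrix_zUnit_trace a) s)) :=
    funext fun s => hφ _
  rw [heq]
  have h := hasDerivAt_comp_ringCoord_seamCurve (L := L) ℓ.contDiff x (quatMatrix_zUnit_conjTranspose a) (quatMatrix_zUnit_trace a) P t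
  refine h.congr_deriv ?_
  rw [ℓ.fderiv, hℓ, sum_imEntry_seamTangent, imEntry_coe_mul_quatMatrix, zseamDeriv]

/-- The three first-row entry functionals of a `2×2` complex matrix are smooth (real-linear). [folklore] -/
theorem contDiff_imEntry (a : Fin 3) :
    ContDiff ℝ ∞ fun X : Matrix (Fin 2) (Fin 2) ℂ => (![(X 0 0).im, (X 0 1).re, (X 0 1).im] : Fin 3 → ℝ) a := by
  have h1 : ContDiff ℝ ∞ fun X : Matrix (Fin 2) (Fin 2) ℂ => (X 0 0).im :=
    (LinearMap.toContinuousLinearMap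
      { toFun := fun X : Matrix (Fin 2) (Fin 2) ℂ => (X 0 0).im, map_add' := fun X Y => by simp, map_smul' := fun c X => by simp }).contDiff
  have h2 : ContDiff ℝ ∞ fun X : Matrix (Fin 2) (Fin 2) ℂ => (X 0 1).re :=
    (LinearMap.toContinuousLinearMap
      { toFun := fun X : Matrix (Fin 2) (Fin 2) ℂ => (X 0 1).re, map_add' := fun X Y => by simp, map_smul' := fun c X => by simp }).contDiff
  have h3 : ContDiff ℝ ∞ fun X : Matrix (Fin 2) (Fin 2) ℂ => (X 0 1).im :=
    (LinearMap.toContinuousLinearMap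
      { toFun := fun X : Matrix (Fin 2) (Fin 2) ℂ => (X 0 1).im, map_add' := fun X Y => by simp, map_smul' := fun c X => by simp }).contDiff
  fin_cases a
  · simpa using h1
  · simpa using h2
  · simpa using h3

/-- The slice-block derivative factors through the coordinates by a continuous function. [folklore] -/
theorem zsliceDeriv_eq_comp (σ : ℝ) (k a : Fin 3) (i : Fin (2 * L - 1 + 1)) (x : Site 3 L)
    (P : (Fin (2 * L - 1 + 1) → GaugeConfig 3 L SU2) × (Site 3 L → SU2)) :
    zsliceDeriv L σ k a i x P =
      (fun M : (Fin (2 * L - 1 + 1) → Edge 3 L → Matrix (Fin 2) (Fin 2) ℂ) × (Site 3 L → Matrix (Fin 2) (Fin 2) ℂ) =>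
        (1 / 2 : ℝ) * σ * ((![((M.1 i (x, k) * quatMatrix (zUnit a)) 0 0).im, ((M.1 i (x, k) * quatMatrix (zUnit a)) 0 1).re,
          ((M.1 i (x, k) * quatMatrix (zUnit a)) 0 1).im] : Fin 3 → ℝ) a / (((2 * L - 1 + 1 : ℕ) : ℝ) * (L : ℝ) ^ 3)))
        (ringCoord L P) := by
  simp only [zsliceDeriv, ringCoord]
  rw [imEntry_coe_mul_quatMatrix]

/-- The seam-block derivative factors through the coordinates by a continuous function. [folklore] -/
theorem zseamDeriv_eq_comp (σ : ℝ) (a : Fin 3) (x : Site 3 L) (P : (Fin (2 * L - 1 + 1) → GaugeConfig 3 L SU2) × (Site 3 L → SU2)) :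
    zseamDeriv L σ a x P =
      (fun M : (Fin (2 * L - 1 + 1) → Edge 3 L → Matrix (Fin 2) (Fin 2) ℂ) × (Site 3 L → Matrix (Fin 2) (Fin 2) ℂ) =>
        (1 / 2 : ℝ) * σ * ((![((M.2 x * quatMatrix (zUnit a)) 0 0).im, ((M.2 x * quatMatrix (zUnit a)) 0 1).re,
          ((M.2 x * quatMatrix (zUnit a)) 0 1).im] : Fin 3 → ℝ) a / ((L : ℝ) ^ 3))) (ringCoord L P) := by
  simp only [zseamDeriv, ringCoord]
  rw [imEntry_coe_mul_quatMatrix]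

/-- ★ **Regularity of the slice-block coefficient and of its own-curve derivative** (measurable ∕ bounded ∕ continuous ∕ strongly
measurable — the `hφm`, `hφb`, `hDφb`, `hDφm` clauses of the Euler-field hypothesis for this part of the field). [folklore] -/
theorem zslice_regular (σ : ℝ) (k a : Fin 3) (i : Fin (2 * L - 1 + 1)) (x : Site 3 L) :
    (Measurable (zsliceCoeff L σ k a) ∧ ∃ B : ℝ, ∀ P, |zsliceCoeff L σ k a P| ≤ B) ∧
    (Continuous (zsliceDeriv L σ k a i x) ∧ (∃ B : ℝ, ∀ P, |zsliceDeriv L σ k a i x P| ≤ B) ∧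
      StronglyMeasurable (zsliceDeriv L σ k a i x)) := by
  obtain ⟨ℓ, -, hφ⟩ := exists_zsliceCoeff_clm (L := L) σ k a
  have hco : zsliceCoeff L σ k a = fun P => ℓ (ringCoord L P) := funext hφ
  have r1 := regular_comp_ringCoord (L := L) ℓ.continuous
  have hg : Continuous fun M : (Fin (2 * L - 1 + 1) → Edge 3 L → Matrix (Fin 2) (Fin 2) ℂ) × (Site 3 L → Matrix (Fin 2) (Fin 2) ℂ) =>
      (1 / 2 : ℝ) * σ * ((![((M.1 i (x, k) * quatMatrix (zUnit a)) 0 0).im, ((M.1 i (x, k) * quatMatrix (zUnit a)) 0 1).re,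
        ((M.1 i (x, k) * quatMatrix (zUnit a)) 0 1).im] : Fin 3 → ℝ) a / (((2 * L - 1 + 1 : ℕ) : ℝ) * (L : ℝ) ^ 3)) := by
    have hm : ContDiff ℝ ∞ fun M : (Fin (2 * L - 1 + 1) → Edge 3 L → Matrix (Fin 2) (Fin 2) ℂ) × (Site 3 L → Matrix (Fin 2) (Fin 2) ℂ) =>
        M.1 i (x, k) * quatMatrix (zUnit a) := (contDiff_coord_fst i (x, k)).mul contDiff_const
    exact (contDiff_const.mul (((contDiff_imEntry a).comp hm).div_const _)).continuous
  have r2 := regular_comp_ringCoord (L := L) hg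
  have hde : zsliceDeriv L σ k a i x = fun P => (fun M : (Fin (2 * L - 1 + 1) → Edge 3 L → Matrix (Fin 2) (Fin 2) ℂ) ×
      (Site 3 L → Matrix (Fin 2) (Fin 2) ℂ) =>
        (1 / 2 : ℝ) * σ * ((![((M.1 i (x, k) * quatMatrix (zUnit a)) 0 0).im, ((M.1 i (x, k) * quatMatrix (zUnit a)) 0 1).re,
          ((M.1 i (x, k) * quatMatrix (zUnit a)) 0 1).im] : Fin 3 → ℝ) a / (((2 * L - 1 + 1 : ℕ) : ℝ) * (L : ℝ) ^ 3))) (ringCoord L P) :=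
    funext fun P => zsliceDeriv_eq_comp σ k a i x P
  refine ⟨⟨?_, ?_⟩, ?_, ?_, ?_⟩
  · rw [hco]; exact r1.2.2.measurable
  · rw [hco]; exact r1.2.1
  · rw [hde]; exact r2.1
  · rw [hde]; exact r2.2.1
  · rw [hde]; exact r2.2.2

/-- ★ **Regularity of the seam-block coefficient and of its own-curve derivative.** [folklore] -/
theorem zseam_regular (σ : ℝ) (a : Fin 3) (x : Site 3 L) :
    (Measurable (zseamCoeff L σ a) ∧ ∃ B : ℝ, ∀ P, |zseamCoeff L σ a P| ≤ B) ∧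
    (Continuous (zseamDeriv L σ a x) ∧ (∃ B : ℝ, ∀ P, |zseamDeriv L σ a x P| ≤ B) ∧ StronglyMeasurable (zseamDeriv L σ a x)) := by
  obtain ⟨ℓ, -, hφ⟩ := exists_zseamCoeff_clm (L := L) σ a
  have hco : zseamCoeff L σ a = fun P => ℓ (ringCoord L P) := funext hφ
  have r1 := regular_comp_ringCoord (L := L) ℓ.continuous
  have hg : Continuous fun M : (Fin (2 * L - 1 + 1) → Edge 3 L → Matrix (Fin 2) (Fin 2) ℂ) × (Site 3 L → Matrix (Fin 2) (Fin 2) ℂ) =>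
      (1 / 2 : ℝ) * σ * ((![((M.2 x * quatMatrix (zUnit a)) 0 0).im, ((M.2 x * quatMatrix (zUnit a)) 0 1).re,
        ((M.2 x * quatMatrix (zUnit a)) 0 1).im] : Fin 3 → ℝ) a / ((L : ℝ) ^ 3)) := by
    have hm : ContDiff ℝ ∞ fun M : (Fin (2 * L - 1 + 1) → Edge 3 L → Matrix (Fin 2) (Fin 2) ℂ) × (Site 3 L → Matrix (Fin 2) (Fin 2) ℂ) =>
        M.2 x * quatMatrix (zUnit a) := (contDiff_coord_snd x).mul contDiff_const
    exact (contDiff_const.mul (((contDiff_imEntry a).comp hm).div_const _)).continuous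
  have r2 := regular_comp_ringCoord (L := L) hg
  have hde : zseamDeriv L σ a x = fun P => (fun M : (Fin (2 * L - 1 + 1) → Edge 3 L → Matrix (Fin 2) (Fin 2) ℂ) ×
      (Site 3 L → Matrix (Fin 2) (Fin 2) ℂ) =>
        (1 / 2 : ℝ) * σ * ((![((M.2 x * quatMatrix (zUnit a)) 0 0).im, ((M.2 x * quatMatrix (zUnit a)) 0 1).re,
          ((M.2 x * quatMatrix (zUnit a)) 0 1).im] : Fin 3 → ℝ) a / ((L : ℝ) ^ 3))) (ringCoord L P) :=
    funext fun P => zseamDeriv_eq_comp σ a x P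
  refine ⟨⟨?_, ?_⟩, ?_, ?_, ?_⟩
  · rw [hco]; exact r1.2.2.measurable
  · rw [hco]; exact r1.2.1
  · rw [hde]; exact r2.1
  · rw [hde]; exact r2.2.1
  · rw [hde]; exact r2.2.2

/-! ## §4 The exact divergence of the zero-mode block field -/

/-- ★★★ **The divergence of the zero-mode block field, exactly**: summing the own-curve derivatives over ALL directions — slice blocks
`((i,(x,k)), a)` with signs `σ k` and the seam block `(x, a)` with sign `σ₄` — gives `(3/2)·(Σ_k σ_k·⟨Re q⟩_{B_k} + σ₄·⟨Re q⟩_{seam})`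
(block AVERAGES of the real parts). [cite: CosteEtAl1985] -/
theorem zeroModeField_div_eq (σ : Fin 3 → ℝ) (σ₄ : ℝ) (P : (Fin (2 * L - 1 + 1) → GaugeConfig 3 L SU2) × (Site 3 L → SU2)) :
    (∑ i : Fin (2 * L - 1 + 1), ∑ x : Site 3 L, ∑ k : Fin 3, ∑ a : Fin 3, zsliceDeriv L (σ k) k a i x P) +
      ∑ x : Site 3 L, ∑ a : Fin 3, zseamDeriv L σ₄ a x P =
    (3 / 2 : ℝ) * ((∑ i : Fin (2 * L - 1 + 1), ∑ x : Site 3 L, ∑ k : Fin 3, σ k * (su2Quat (P.1 i (x, k))).re) /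
        (((2 * L - 1 + 1 : ℕ) : ℝ) * (L : ℝ) ^ 3)) +
      (3 / 2 : ℝ) * σ₄ * ((∑ x : Site 3 L, (su2Quat (P.2 x)).re) / ((L : ℝ) ^ 3)) := by
  have hslice : ∀ (i : Fin (2 * L - 1 + 1)) (x : Site 3 L) (k : Fin 3),
      ∑ a : Fin 3, zsliceDeriv L (σ k) k a i x P = (3 / 2 : ℝ) * (σ k * (su2Quat (P.1 i (x, k))).re) / (((2 * L - 1 + 1 : ℕ) : ℝ) * (L : ℝ) ^ 3) := by
    intro i x k
    have h := sum_im_mul_zUnit (su2Quat (P.1 i (x, k)))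
    simp only [zsliceDeriv]
    rw [← Finset.mul_sum, ← Finset.sum_div, h]
    ring
  have hseam : ∀ x : Site 3 L, ∑ a : Fin 3, zseamDeriv L σ₄ a x P = (3 / 2 : ℝ) * σ₄ * (su2Quat (P.2 x)).re / ((L : ℝ) ^ 3) := by
    intro x
    have h := sum_im_mul_zUnit (su2Quat (P.2 x))
    simp only [zseamDeriv]
    rw [← Finset.mul_sum, ← Finset.sum_div, h]
    ring
  simp only [hslice, hseam]
  simp only [Finset.sum_div, Finset.mul_sum]
  congr 1
  · refine Finset.sum_congr rfl fun i _ => Finset.sum_congr rfl fun x _ => Finset.sum_congr rfl fun k _ => ?_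
    ring
  · refine Finset.sum_congr rfl fun x _ => ?_
    ring

/-- `|σ·Re q| ≤ 1` for a unit quaternion and `|σ| ≤ 1`. [folklore] -/
theorem abs_sigma_mul_re_le {σ : ℝ} (hσ : |σ| ≤ 1) (U : SU2) : |σ * (su2Quat U).re| ≤ 1 := by
  rw [abs_mul]
  have h := abs_re_su2Quat_le U
  calc |σ| * |(su2Quat U).re| ≤ 1 * 1 := mul_le_mul hσ h (abs_nonneg _) zero_le_one
    _ = 1 := one_mul 1

/-- ★★★ **The divergence of the zero-mode block field is at most `6 = 12 × ½`** everywhere on the ring space, for all block signs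
`|σ_k|, |σ₄| ≤ 1`. [cite: CosteEtAl1985] -/
theorem zeroModeField_div_le {σ : Fin 3 → ℝ} {σ₄ : ℝ} (hσ : ∀ k, |σ k| ≤ 1) (hσ₄ : |σ₄| ≤ 1)
    (P : (Fin (2 * L - 1 + 1) → GaugeConfig 3 L SU2) × (Site 3 L → SU2)) :
    (∑ i : Fin (2 * L - 1 + 1), ∑ x : Site 3 L, ∑ k : Fin 3, ∑ a : Fin 3, zsliceDeriv L (σ k) k a i x P) +
      ∑ x : Site 3 L, ∑ a : Fin 3, zseamDeriv L σ₄ a x P ≤ 6 := by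
  rw [zeroModeField_div_eq]
  have hL : (0 : ℝ) < (L : ℝ) := by exact_mod_cast NeZero.pos L
  have hL3 : (0 : ℝ) < (L : ℝ) ^ 3 := by positivity
  have hN : (0 : ℝ) < ((2 * L - 1 + 1 : ℕ) : ℝ) * (L : ℝ) ^ 3 := by positivity
  have hsite : (Fintype.card (Site 3 L) : ℝ) = (L : ℝ) ^ 3 := by
    rw [TwoLattice.Electric.card_site]; push_cast; ring
  -- slice blocks: the triple sum is at most `3 · N`
  have h1 : (∑ i : Fin (2 * L - 1 + 1), ∑ x : Site 3 L, ∑ k : Fin 3, σ k * (su2Quat (P.1 i (x, k))).re) ≤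
      3 * (((2 * L - 1 + 1 : ℕ) : ℝ) * (L : ℝ) ^ 3) := by
    calc (∑ i : Fin (2 * L - 1 + 1), ∑ x : Site 3 L, ∑ k : Fin 3, σ k * (su2Quat (P.1 i (x, k))).re)
        ≤ ∑ i : Fin (2 * L - 1 + 1), ∑ x : Site 3 L, ∑ k : Fin 3, (1 : ℝ) :=
          Finset.sum_le_sum fun i _ => Finset.sum_le_sum fun x _ => Finset.sum_le_sum fun k _ =>
            (le_abs_self _).trans (abs_sigma_mul_re_le (hσ k) _)
      _ = 3 * (((2 * L - 1 + 1 : ℕ) : ℝ) * (L : ℝ) ^ 3) := by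
          simp only [Finset.sum_const, Finset.card_univ, Fintype.card_fin, nsmul_eq_mul, mul_one]
          rw [hsite]; push_cast; ring
  -- seam block: the sum is at most `L³`
  have h2 : σ₄ * (∑ x : Site 3 L, (su2Quat (P.2 x)).re) ≤ (L : ℝ) ^ 3 := by
    rw [Finset.mul_sum]
    calc ∑ x : Site 3 L, σ₄ * (su2Quat (P.2 x)).re ≤ ∑ x : Site 3 L, (1 : ℝ) :=
          Finset.sum_le_sum fun x _ => (le_abs_self _).trans (abs_sigma_mul_re_le hσ₄ _)
      _ = (L : ℝ) ^ 3 := by simp only [Finset.sum_const, Finset.card_univ, nsmul_eq_mul, mul_one, hsite]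
  have h1' : (∑ i : Fin (2 * L - 1 + 1), ∑ x : Site 3 L, ∑ k : Fin 3, σ k * (su2Quat (P.1 i (x, k))).re) /
      (((2 * L - 1 + 1 : ℕ) : ℝ) * (L : ℝ) ^ 3) ≤ 3 := by
    rw [div_le_iff₀ hN]; linarith
  have h2' : σ₄ * ((∑ x : Site 3 L, (su2Quat (P.2 x)).re) / (L : ℝ) ^ 3) ≤ 1 := by
    rw [← mul_div_assoc, div_le_iff₀ hL3]; linarith
  nlinarith

end Summit.QuantumFields.YangMills.Theorems.VirialFluxGap.FrameDerivative

end
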